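import Summits.BirchSwinnertonDyer.BirchSwinnertonDyer.Theorems.Rank2Observatory4528a1TwoDescClCert1
import Summits.BirchSwinnertonDyer.BirchSwinnertonDyer.Theorems.Rank2ObservatoryKernelCerts054
import HarnessLib

/-!
# BirchSwinnertonDyer — rank ≥ 2 observatory: `rank E(ℚ) = 2` for `4528a1` by class-group-general 2-descent (KERNEL-2DESC-CL)

HONEST FRAMING: per-curve certified theorems and census instruments; no claim on BSD in rank ≥ 2.

Per-CURVE file of the KERNEL-2DESC-CL instrument (design `b2b-bsdr2-cert-1/KERNEL-2DESC-CL.md`, Design U,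
pilot field `-283`): the census curve `4528a1 = [0, 1, 0, -4, 12]` (conductor `4528`) has trivial rational `2`-torsion
(`F = X³ + (1)X² + (-4)X + (12)` has no root mod `7`); its `2`-division field is the cubic field `K = ℚ(α)`,
`α³ = (1 - 4 * α)` (`Δ_K = -283`, class number `2` — NOT a PID, so the PID instrument of cert-3 does not apply;
file `Rank2ObservatoryCubicFieldClM283`), with `θ = (-3 - α - α ^ 2)` a root of `F` and `D = F′(θ) = (23 - 5 * α + 7 * α ^ 2)`,
`|N(D)| = 2^4 · 283^1`.  CLASS-GROUP-GENERAL `2`-DESCENT (Cassels' `x − θ` map into `K(T,2)`): with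
`M = D·19` and `T` = the `4` primes `W1v, W2v, P2i1, P283i0` containing `M` (their classes generate `Cl(K)`:
`FieldClM283.closure19_eq_top` transferred to `M`), the image of `E(ℚ)/2E(ℚ)` lies in `U_T/U_T²`
(`exists_tsupp_eq_mul_sq_of_closure_eq_top`); the explicit family of `n = 6 = r + 1 + t` `T`-units
`uNeg, uFund, gW, gQ, g2i1, g283i0` is independent modulo squares (parity certificate: real sign, valuations at `W₁`, `W₂`,
Legendre characters at the degree-1 primes above `[3, 5, 31]`; certificate matrix of rank `6` checked by `decide`)
hence spans `U_T/U_T²` (`exists_isSquare_tunit_mul_prod`, Dirichlet), and the kernel sieve (norm square residues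
mod `[8]`, real sign, parity of `ord_{W₁}`, `ord_{W₂}` — both valid because `D ∉ W₁, W₂`) admits exactly the `4` classes
`[[], [0, 1], [2], [0, 1, 2]]`, whence `rank ≤ 2` (`mordellWeilRank_le_of_coverSet_cl`); with the tree lower bound
`KernelCerts054.C4528a1.two_le_rank` (`Rank2ObservatoryKernelCerts054`, p206519), `rank E(ℚ) = 2`.

Certificate data: kit job `j142972` (`pilotcl_283.json`, PARI), independently re-derived and checked in exact
arithmetic by the generator (`pilotcl/gen_clcurve.py` + `polyz.py`: identities modulo `g`, norms two ways,
membership/inverse certificates, character values, F₂ rank and the brute-forced certificate statement, the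
admissible count). Theorems only (no defs). Sorry-free; axioms `propext`, `Classical.choice`, `Quot.sound`.
[cite: Cassels1991LecturesEllipticCurves, §15] [cite: CremonaAlgorithms1997, §3.6 (2-descent), §3.5 (label `4528a1`)] [cite: Cohen1993, §4.8.2, §6.5]
-/

-- single-conjunct summit: `Summit.BirchSwinnertonDyer.BirchSwinnertonDyer.…` repeats the name by design
set_option linter.dupNamespace false

noncomputable section

open scoped Classical NumberField nonZeroDivisors

open Literature.NumberTheory.NumberFields Polynomial Module NumberField IsDedekindDomain Ideal

namespace Summit.BirchSwinnertonDyer.BirchSwinnertonDyer.Rank2Observatory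

namespace C4528a1

open TwoDescCubic TwoDescCubic.FieldClM283 TwoDescCl

/-! ## The kernel sieve: norm square residues mod `[8]`, real sign, parities of `ord_{W₁}`, `ord_{W₂}` -/

/-- The empty class is admissible. [folklore] -/
theorem adm_empty : (fun (T : Finset (Fin 0)) (U : Finset (Fin 6)) => (admStdQ [8] (![] : Fin 0 → ℤ) (![-1, -1, 361, 6859, 76, -283] : Fin 6 → ℤ) (![] : Fin 0 → Bool) (![true, true, false, false, false, true] : Fin 6 → Bool) T U && (decide (Even (Finset.card (Finset.filter (fun j => (![false, false, false, true, true, false] : Fin 6 → Bool) j = true) U))) && decide (Even (Finset.card (Finset.filter (fun j => (![false, false, false, true, false, false] : Fin 6 → Bool) j = true) U)))))) ∅ ∅ = true := by decide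

/-- **Soundness of the sieve at rational points**: norm-square-residue and sign tests (`admStd_sound`) and the
parity of `ord_{W₁}`, `ord_{W₂}` (`valRow_sound`, valid since `D ∉ W₁, W₂`). [cite: Cassels1991LecturesEllipticCurves, §15] -/
theorem adm_of_point (ρ : (CubicField 0 4 (-1)) →+* ℝ) (hlo : ((123/500 : ℚ) : ℝ) < ρ (CubicField.root 0 4 (-1))) (hhi : ρ (CubicField.root 0 4 (-1)) < ((247/1000 : ℚ) : ℝ)) :
    ∀ x y : ℚ, y ^ 2 = x ^ 3 + ((1 : ℤ) : ℚ) * x ^ 2 + ((-4 : ℤ) : ℚ) * x + ((12 : ℤ) : ℚ) →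
    ∀ (T : Finset (Fin 0)) (U : Finset (Fin 6)),
      IsSquare ((algebraMap ℚ (CubicField 0 4 (-1)) x - algebraMap (𝓞 (CubicField 0 4 (-1))) (CubicField 0 4 (-1)) (lin aeval_α (-3) (-1) (-1) : 𝓞 (CubicField 0 4 (-1)))) *
        (∏ i ∈ T, algebraMap (𝓞 (CubicField 0 4 (-1))) (CubicField 0 4 (-1)) ((![] : Fin 0 → (𝓞 (CubicField 0 4 (-1)))ˣ) i)) * ∏ j ∈ U, algebraMap (𝓞 (CubicField 0 4 (-1))) (CubicField 0 4 (-1)) ((![lin aeval_α (-1) 0 0, lin aeval_α (-4) 0 (-1), lin aeval_α 10 0 1, lin aeval_α 19 0 0, lin aeval_α 7 1 1, lin aeval_α (-4) 0 (-3)] : Fin 6 → 𝓞 (CubicField 0 4 (-1))) j)) →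
      (fun (T : Finset (Fin 0)) (U : Finset (Fin 6)) => (admStdQ [8] (![] : Fin 0 → ℤ) (![-1, -1, 361, 6859, 76, -283] : Fin 6 → ℤ) (![] : Fin 0 → Bool) (![true, true, false, false, false, true] : Fin 6 → Bool) T U && (decide (Even (Finset.card (Finset.filter (fun j => (![false, false, false, true, true, false] : Fin 6 → Bool) j = true) U))) && decide (Even (Finset.card (Finset.filter (fun j => (![false, false, false, true, false, false] : Fin 6 → Bool) j = true) U)))))) T U = true := by
  intro x y hE T U hsq
  have hq := cofactor_pos_of_disc_neg (rho_theta_root ρ aeval_theta)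
    (by norm_num [MonicCubic.disc] : MonicCubic.disc 1 (-4) 12 < 0)
  have h1 : admStd (![] : Fin 0 → ℤ) (![-1, -1, 361, 6859, 76, -283] : Fin 6 → ℤ) (![] : Fin 0 → Bool) (![true, true, false, false, false, true] : Fin 6 → Bool) T U = true := by
    refine admStd_sound irreducible_F aeval_theta finrank_eq ρ hq (fun i => i.elim0)
      (fun j => RingOfIntegers.coe_ne_zero_iff.mpr (family_ne_zero j)) (fun i => i.elim0) ?_ (fun i => i.elim0) ?_
      x y hE T U hsq
    · intro j
      fin_cases j
      · exact uNeg_norm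
      · exact uFund_norm
      · exact gW_norm
      · exact gQ_norm
      · exact g2i1_norm
      · exact g283i0_norm
    · intro j
      fin_cases j
      · simpa using uNeg_neg ρ hlo hhi
      · simpa using uFund_neg ρ hlo hhi
      · simpa using (gW_pos ρ hlo hhi).le
      · simpa using (gQ_pos ρ hlo hhi).le
      · simpa using (g2i1_pos ρ hlo hhi).le
      · simpa using g283i0_neg ρ hlo hhi
  have h2 := valRow_sound theta_rel theta_not_rat W1v (by rw [deriv_eq]; exact D_notMem_W1v) family_ne_zero
    (r := (![false, false, false, true, true, false] : Fin 6 → Bool)) (fun j => by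
      fin_cases j
      · show (false = true ↔ ¬ (2 : ℤ) ∣ WithZero.log (W1v.valuation (CubicField 0 4 (-1)) (algebraMap (𝓞 (CubicField 0 4 (-1))) (CubicField 0 4 (-1)) (lin aeval_α (-1) 0 0 : 𝓞 (CubicField 0 4 (-1))))))
        rw [show algebraMap (𝓞 (CubicField 0 4 (-1))) (CubicField 0 4 (-1)) (lin aeval_α (-1) 0 0 : 𝓞 (CubicField 0 4 (-1))) = ((lin aeval_α (-1) 0 0 : 𝓞 (CubicField 0 4 (-1))) : (CubicField 0 4 (-1))) from rfl, uNeg_logW1]; decide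
      · show (false = true ↔ ¬ (2 : ℤ) ∣ WithZero.log (W1v.valuation (CubicField 0 4 (-1)) (algebraMap (𝓞 (CubicField 0 4 (-1))) (CubicField 0 4 (-1)) (lin aeval_α (-4) 0 (-1) : 𝓞 (CubicField 0 4 (-1))))))
        rw [show algebraMap (𝓞 (CubicField 0 4 (-1))) (CubicField 0 4 (-1)) (lin aeval_α (-4) 0 (-1) : 𝓞 (CubicField 0 4 (-1))) = ((lin aeval_α (-4) 0 (-1) : 𝓞 (CubicField 0 4 (-1))) : (CubicField 0 4 (-1))) from rfl, uFund_logW1]; decide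
      · show (false = true ↔ ¬ (2 : ℤ) ∣ WithZero.log (W1v.valuation (CubicField 0 4 (-1)) (algebraMap (𝓞 (CubicField 0 4 (-1))) (CubicField 0 4 (-1)) (lin aeval_α 10 0 1 : 𝓞 (CubicField 0 4 (-1))))))
        rw [show algebraMap (𝓞 (CubicField 0 4 (-1))) (CubicField 0 4 (-1)) (lin aeval_α 10 0 1 : 𝓞 (CubicField 0 4 (-1))) = ((lin aeval_α 10 0 1 : 𝓞 (CubicField 0 4 (-1))) : (CubicField 0 4 (-1))) from rfl, gW_logW1]; decide
      · show (true = true ↔ ¬ (2 : ℤ) ∣ WithZero.log (W1v.valuation (CubicField 0 4 (-1)) (algebraMap (𝓞 (CubicField 0 4 (-1))) (CubicField 0 4 (-1)) (lin aeval_α 19 0 0 : 𝓞 (CubicField 0 4 (-1))))))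
        rw [show algebraMap (𝓞 (CubicField 0 4 (-1))) (CubicField 0 4 (-1)) (lin aeval_α 19 0 0 : 𝓞 (CubicField 0 4 (-1))) = ((lin aeval_α 19 0 0 : 𝓞 (CubicField 0 4 (-1))) : (CubicField 0 4 (-1))) from rfl, gQ_logW1]; decide
      · show (true = true ↔ ¬ (2 : ℤ) ∣ WithZero.log (W1v.valuation (CubicField 0 4 (-1)) (algebraMap (𝓞 (CubicField 0 4 (-1))) (CubicField 0 4 (-1)) (lin aeval_α 7 1 1 : 𝓞 (CubicField 0 4 (-1))))))
        rw [show algebraMap (𝓞 (CubicField 0 4 (-1))) (CubicField 0 4 (-1)) (lin aeval_α 7 1 1 : 𝓞 (CubicField 0 4 (-1))) = ((lin aeval_α 7 1 1 : 𝓞 (CubicField 0 4 (-1))) : (CubicField 0 4 (-1))) from rfl, g2i1_logW1]; decide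
      · show (false = true ↔ ¬ (2 : ℤ) ∣ WithZero.log (W1v.valuation (CubicField 0 4 (-1)) (algebraMap (𝓞 (CubicField 0 4 (-1))) (CubicField 0 4 (-1)) (lin aeval_α (-4) 0 (-3) : 𝓞 (CubicField 0 4 (-1))))))
        rw [show algebraMap (𝓞 (CubicField 0 4 (-1))) (CubicField 0 4 (-1)) (lin aeval_α (-4) 0 (-3) : 𝓞 (CubicField 0 4 (-1))) = ((lin aeval_α (-4) 0 (-3) : 𝓞 (CubicField 0 4 (-1))) : (CubicField 0 4 (-1))) from rfl, g283i0_logW1]; decide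
      ) x y hE T U hsq
  have h3 := valRow_sound theta_rel theta_not_rat W2v (by rw [deriv_eq]; exact D_notMem_W2v) family_ne_zero
    (r := (![false, false, false, true, false, false] : Fin 6 → Bool)) (fun j => by
      fin_cases j
      · show (false = true ↔ ¬ (2 : ℤ) ∣ WithZero.log (W2v.valuation (CubicField 0 4 (-1)) (algebraMap (𝓞 (CubicField 0 4 (-1))) (CubicField 0 4 (-1)) (lin aeval_α (-1) 0 0 : 𝓞 (CubicField 0 4 (-1))))))
        rw [show algebraMap (𝓞 (CubicField 0 4 (-1))) (CubicField 0 4 (-1)) (lin aeval_α (-1) 0 0 : 𝓞 (CubicField 0 4 (-1))) = ((lin aeval_α (-1) 0 0 : 𝓞 (CubicField 0 4 (-1))) : (CubicField 0 4 (-1))) from rfl, uNeg_logW2]; decide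
      · show (false = true ↔ ¬ (2 : ℤ) ∣ WithZero.log (W2v.valuation (CubicField 0 4 (-1)) (algebraMap (𝓞 (CubicField 0 4 (-1))) (CubicField 0 4 (-1)) (lin aeval_α (-4) 0 (-1) : 𝓞 (CubicField 0 4 (-1))))))
        rw [show algebraMap (𝓞 (CubicField 0 4 (-1))) (CubicField 0 4 (-1)) (lin aeval_α (-4) 0 (-1) : 𝓞 (CubicField 0 4 (-1))) = ((lin aeval_α (-4) 0 (-1) : 𝓞 (CubicField 0 4 (-1))) : (CubicField 0 4 (-1))) from rfl, uFund_logW2]; decide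
      · show (false = true ↔ ¬ (2 : ℤ) ∣ WithZero.log (W2v.valuation (CubicField 0 4 (-1)) (algebraMap (𝓞 (CubicField 0 4 (-1))) (CubicField 0 4 (-1)) (lin aeval_α 10 0 1 : 𝓞 (CubicField 0 4 (-1))))))
        rw [show algebraMap (𝓞 (CubicField 0 4 (-1))) (CubicField 0 4 (-1)) (lin aeval_α 10 0 1 : 𝓞 (CubicField 0 4 (-1))) = ((lin aeval_α 10 0 1 : 𝓞 (CubicField 0 4 (-1))) : (CubicField 0 4 (-1))) from rfl, gW_logW2]; decide
      · show (true = true ↔ ¬ (2 : ℤ) ∣ WithZero.log (W2v.valuation (CubicField 0 4 (-1)) (algebraMap (𝓞 (CubicField 0 4 (-1))) (CubicField 0 4 (-1)) (lin aeval_α 19 0 0 : 𝓞 (CubicField 0 4 (-1))))))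
        rw [show algebraMap (𝓞 (CubicField 0 4 (-1))) (CubicField 0 4 (-1)) (lin aeval_α 19 0 0 : 𝓞 (CubicField 0 4 (-1))) = ((lin aeval_α 19 0 0 : 𝓞 (CubicField 0 4 (-1))) : (CubicField 0 4 (-1))) from rfl, gQ_logW2]; decide
      · show (false = true ↔ ¬ (2 : ℤ) ∣ WithZero.log (W2v.valuation (CubicField 0 4 (-1)) (algebraMap (𝓞 (CubicField 0 4 (-1))) (CubicField 0 4 (-1)) (lin aeval_α 7 1 1 : 𝓞 (CubicField 0 4 (-1))))))
        rw [show algebraMap (𝓞 (CubicField 0 4 (-1))) (CubicField 0 4 (-1)) (lin aeval_α 7 1 1 : 𝓞 (CubicField 0 4 (-1))) = ((lin aeval_α 7 1 1 : 𝓞 (CubicField 0 4 (-1))) : (CubicField 0 4 (-1))) from rfl, g2i1_logW2]; decide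
      · show (false = true ↔ ¬ (2 : ℤ) ∣ WithZero.log (W2v.valuation (CubicField 0 4 (-1)) (algebraMap (𝓞 (CubicField 0 4 (-1))) (CubicField 0 4 (-1)) (lin aeval_α (-4) 0 (-3) : 𝓞 (CubicField 0 4 (-1))))))
        rw [show algebraMap (𝓞 (CubicField 0 4 (-1))) (CubicField 0 4 (-1)) (lin aeval_α (-4) 0 (-3) : 𝓞 (CubicField 0 4 (-1))) = ((lin aeval_α (-4) 0 (-3) : 𝓞 (CubicField 0 4 (-1))) : (CubicField 0 4 (-1))) from rfl, g283i0_logW2]; decide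
      ) x y hE T U hsq
  simp only [Bool.and_eq_true]
  exact ⟨admStdQ_of_admStd (by decide) h1, h2, h3⟩

/-! ## `rank E(ℚ) = 2` -/

/-- **`rank E(ℚ) ≤ 2` for `4528a1`** by class-group-general `2`-descent over `ℚ(α)`: `4` admissible classes
(counted by `decide` in the kernel). [cite: Cassels1991LecturesEllipticCurves, §15] -/
theorem mordellWeilRank_le_two : haveI := isElliptic; ((⟨0, 1, 0, -4, 12⟩ : WeierstrassCurve ℚ)).mordellWeilRank ≤ 2 := by
  haveI := isElliptic
  obtain ⟨ρ, hlo, hhi⟩ := FieldClM283.exists_rho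
  exact mordellWeilRank_le_of_coverSet_cl (A := 1) (B := (-4)) (C := 12) (⟨0, 1, 0, -4, 12⟩ : WeierstrassCurve ℚ) rfl (by norm_num) rfl
    (by norm_num) (by norm_num) irreducible_F aeval_theta finrank_eq M_ne_zero closure_M_eq_top deriv_mem
    (W := (![lin aeval_α (-1) 0 0, lin aeval_α (-4) 0 (-1), lin aeval_α 10 0 1, lin aeval_α 19 0 0, lin aeval_α 7 1 1, lin aeval_α (-4) 0 (-3)] : Fin 6 → 𝓞 (CubicField 0 4 (-1)))) family_ne_zero family_span (Wu := ![]) (adm := (fun (T : Finset (Fin 0)) (U : Finset (Fin 6)) => (admStdQ [8] (![] : Fin 0 → ℤ) (![-1, -1, 361, 6859, 76, -283] : Fin 6 → ℤ) (![] : Fin 0 → Bool) (![true, true, false, false, false, true] : Fin 6 → Bool) T U && (decide (Even (Finset.card (Finset.filter (fun j => (![false, false, false, true, true, false] : Fin 6 → Bool) j = true) U))) && decide (Even (Finset.card (Finset.filter (fun j => (![false, false, false, true, false, false] : Fin 6 → Bool) j = true) U))))))) adm_empty (adm_of_point ρ hlo hhi)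
    (s' := 2) (by decide +kernel)

/-- **`rank E(ℚ) = 2` for `4528a1`** (upper bound: this file; lower bound: the tree kernel certificate `KernelCerts054.C4528a1.two_le_rank` (`Rank2ObservatoryKernelCerts054`, p206519)).
[cite: CremonaAlgorithms1997, §3.5 (Cremona label `4528a1`)] -/
theorem mordellWeilRank_eq_two :
    ((⟨0, 1, 0, -4, 12⟩ : WeierstrassCurve ℤ).map (Int.castRingHom ℚ)).mordellWeilRank = 2 := by
  have hE : (⟨0, 1, 0, -4, 12⟩ : WeierstrassCurve ℤ).map (Int.castRingHom ℚ) = (⟨0, 1, 0, -4, 12⟩ : WeierstrassCurve ℚ) := by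
    ext <;> simp [WeierstrassCurve.map]
  refine le_antisymm ?_ (KernelCerts054.C4528a1.two_le_rank)
  rw [hE]
  exact mordellWeilRank_le_two

end C4528a1

end Summit.BirchSwinnertonDyer.BirchSwinnertonDyer.Rank2Observatory

end
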